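/-
Copyright: the b2b-balaban cell (near-miss cell 7), T⁴-continuum fan-out; row NE7b ROUND-2 swarm, seat
t4-ne7b-formalise-leaf-10 (gen 2; row S6g′(b) of `t4/b2b-balaban-t4-ne7b-p1/LEAVES-NE7b.md`, owner's ruling
R-OWNER-22-12 (2)).  Released under the licence of the surrounding project.
-/
import Summits.QuantumFields.BalabanUV.T4Continuum.Support.ZoneDrivers

/-!
# Mass placement: the MASS-FORM multiplicity of positioned genealogies (row S6g′(b), exponent ONE)

Summits-side support leaf of the T⁴-continuum cell (rung (B)+1 on a FINITE torus only; NOT infinite volume, NOT the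
mass gap, NOT the Clay statement; NOT a proof of the spine estimate NE7b).  Row NE7b, route «COUNT»; the owner's
re-specified row S6g′ «MASS-BASED SIBLING COUNT» (R-OWNER-22-12 (2), on this lineage's finding F-leaf10-1), its step
(b): the placement count in which a merger's free partner is positioned against the CARDINALITY of an attachable block
set of the other partner — one factor `(#attachable blocks)·(touch count)` per merger, NO `d`-th power of an extent.
[folklore] finite combinatorics, generic in the tag type `ε`, the cell type `γ` and the block type `δ`, in the format
of `Support/ZoneSkeleton` (whose ball form it replaces factor by factor); nothing is quoted from print, nothing printed
is asserted, no `[cite:]` tag, no `Prop`-valued fact is minted (the attachable sets, their cardinality law and the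
touch relation are DISPLAYED data ∕ binders); constants symbolic.

WHY (F-leaf10-1, ruled right by R-OWNER-22-12 (2)).  The zone skeleton (`ZoneSkeleton.AdmZ` ∕ `card_admZSet_le`)
positions the free (younger) root of a merger anywhere in the BALL of radius `ext X + ext Y` around the other root:
`≍ ext^d` cells, and `ext ≍` mass for a crowd of unit siblings, so `k` equal siblings cost `≍ (k^d)^k` placements and
the symmetry credit `k!` of row S6g′(c) leaves `(k!)^{d−1}`.  Physically the free partner TOUCHES the other structure's
zone AS A SET, whose cardinality is at most a constant times its (decayed) formation MASS (row S6g′(a)); then `k`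
siblings cost `≍ (C·k)^k`, and `∕k!` is class-linear (row S6g′(d), `Support/HistorySiblingMass`).

WHAT.  §1 **`AdmM zoneP touch G P`** — MASS-FORM ADMISSIBILITY of a placement `P : ε → γ` (birth cells): at a merger
`merge X Y e` the FREE root (the younger one, `max rootStep`, as in `ZoneSkeleton.zoneW`) sits at a cell that
`touch e`-es SOME block of the ATTACHABLE SET `zoneP e Z P : Finset δ` of the other partner `Z`, read off that partner's
own placement (`zoneP : ε → Gen ε → (ε → γ) → Finset δ` DISPLAYED, local in the births of its structure — `hloc`);
locality `admM_congr`; the mass weight `massW`.  §2 the FIBRED link count **`card_linkP_le`** (=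
`PlacementSkeleton.card_link_le` with a link `R P y` reading the WHOLE placement of the fixed block, local in it, fibres
`≤ nR` on ADMISSIBLE placements; no disjointness needed) and **`card_admMSet_le`**: for a separated genealogy,
`#{P : AdmM G P, P G.root = c, junk off the births} ≤ massW zmass NT G := ∏_{mergers e} zmass e (fixed partner) · NT e
(free root's scale)`, given the placement-free CARDINALITY MAJORANT `AdmM Z P → #zoneP e Z P ≤ zmass e Z` (`hcard` —
where row S6g′(a)'s law `|zone_t X| ≤ C_z·M_t(X)` plugs in) and the one-block touch count `#{y : touch e a y s} ≤ NT e s`.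
§3 exponent bookkeeping **`massW_le`** ∕ **`card_admMSet_root_le`**: with `NT e s ≤ ν e·Λ^{st e+1−s}` and
`zmass e Z·ν e ≤ f (merge X Y e) e` at every well-formed merge node (`Z` either partner),
`#admMSet ≤ Λ^{partnerAges st G}·mergeProd f G` — ONE factor per merger at EXPONENT ONE; the crowd form
**`card_admMSet_root_le_crowd`** (`zmass ≤ Cz·qZ wt σ st (merge X Y e) (st e)`, `ν = M₀`):
`≤ Λ^{partnerAges}·(M₀·Cz)^{mergeCount G}·mergeProd q_Z G` = the bound of `ZoneDrivers.card_admZSet_root_le_crowd`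
with `q_Z^d ↦ q_Z`.  §4 sanity.  The torus touch relation and its count: `Support/HistoryMassPlacementTorus`.

INTERFACE ∕ LOCATED (rows S6g′(a)(c) and the binding; finding F-leaf10-2 of the cell's records).  The merger index `e`
of `zoneP e` ∕ `touch e` lets the binding choose the attachable set and the touch radius PER MERGER: (i) the whole
accumulated zone of the fixed partner at `st e` (R-OWNER-22-12 (2)(b) verbatim — NOT invariant under permuting equal
siblings, so row S6g′(c) cannot divide THAT count by `k!`: a path of `k` thin siblings hung on a thin host has ONE
prefix-admissible order); (ii) the zone of the PREVIOUS breadth-first LAYER of the host-step (permutation-invariant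
within (layer, shape), still necessary for breadth-first encoded realisations — rows S1b∕S6's contact order) — the
form that symmetrises; (iii) a radius `ρ + ext(Y)` for a COMPOSITE free partner `Y` (whose zone, not root block,
touches).  Nothing here decides among them; nothing of H3 ∕ (B) ∕ BetaPertH.  NE7b NOT proved.

HONEST DEPENDENCY (cell): continuum YM on T⁴ ⇐ BetaPertH ∧ nine spine estimates (0/9 proved); BetaPertH ⇐ (D1) ∧ (D4)
∧ CAP+tail; G-an2-4 gates asym, D1 and NE2/3/4.  This file changes none of it.
-/

open Finset
open Literature.MathematicalPhysics.QuantumFieldTheory.Balaban1983to89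
open T4PersistenceDictionary T4PartnerMultiplicity
open Summit.QuantumFields.BalabanUV.T4Continuum.PlacementSkeleton
open Summit.QuantumFields.BalabanUV.T4Continuum.ZoneSkeleton

namespace Summit.QuantumFields.BalabanUV.T4Continuum.HistoryMassPlacement

noncomputable section

variable {ε : Type*} [DecidableEq ε] {γ δ : Type*}

/-! ## §1 Mass-form admissibility and the mass weight -/

/-- **MASS-FORM ADMISSIBILITY** of a placement `P : ε → γ` (birth cells of the pieces): at every merger `merge X Y e`
the FREE root — the younger one (`Y` if `X.rootStep ≤ Y.rootStep`, else `X`), with its root scale — sits at a cell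
that touches (`touch e`) SOME block of the attachable set `zoneP e Z P` of the OTHER partner `Z`, read off `P`; births
and renewals impose nothing. [folklore] -/
def AdmM (zoneP : ε → Gen ε → (ε → γ) → Finset δ) (touch : ε → δ → γ → ℕ → Prop) : Gen ε → (ε → γ) → Prop
  | Gen.born _ _, _ => True
  | Gen.renew G _ _, P => AdmM zoneP touch G P
  | Gen.merge X Y e, P => AdmM zoneP touch X P ∧ AdmM zoneP touch Y P ∧
      if X.rootStep ≤ Y.rootStep then ∃ a ∈ zoneP e X P, touch e a (P Y.root) Y.rootStep
      else ∃ a ∈ zoneP e Y P, touch e a (P X.root) X.rootStep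

/-- **LOCALITY**: if every attachable set reads the placement only on the births of its structure, mass-form
admissibility reads the placement only on the births. [folklore] -/
theorem admM_congr (zoneP : ε → Gen ε → (ε → γ) → Finset δ)
    (hloc : ∀ (e : ε) (Z : Gen ε) (P P' : ε → γ), (∀ b ∈ births Z, P b = P' b) → zoneP e Z P = zoneP e Z P')
    (touch : ε → δ → γ → ℕ → Prop) :
    ∀ (G : Gen ε) {P P' : ε → γ}, (∀ b ∈ births G, P b = P' b) →
      (AdmM zoneP touch G P ↔ AdmM zoneP touch G P')
  | Gen.born _ _, _, _, _ => Iff.rfl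
  | Gen.renew G _ _, _, _, h => admM_congr zoneP hloc touch G h
  | Gen.merge X Y e, P, P', h => by
      have hX : ∀ b ∈ births X, P b = P' b := fun b hb => h b (mem_union.2 (Or.inl hb))
      have hY : ∀ b ∈ births Y, P b = P' b := fun b hb => h b (mem_union.2 (Or.inr hb))
      simp only [AdmM]
      rw [admM_congr zoneP hloc touch X hX, admM_congr zoneP hloc touch Y hY, hloc e X P P' hX, hloc e Y P P' hY,
        hX _ (root_mem_births X), hY _ (root_mem_births Y)]

omit [DecidableEq ε] in
/-- **THE MASS WEIGHT**: one factor per merger — the cardinality majorant of the fixed partner's attachable set times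
the touch count at the free root's scale. [folklore] -/
def massW (zmass : ε → Gen ε → ℕ) (NT : ε → ℕ → ℕ) : Gen ε → ℕ
  | Gen.born _ _ => 1
  | Gen.renew G _ _ => massW zmass NT G
  | Gen.merge X Y e => massW zmass NT X * massW zmass NT Y *
      (if X.rootStep ≤ Y.rootStep then zmass e X * NT e Y.rootStep else zmass e Y * NT e X.rootStep)

/-! ## §2 The fibred link count and the mass-form multiplicity -/

section Count

variable [Fintype ε] [Fintype γ] [DecidableEq γ]

open scoped Classical

/-- **THE FIBRED LINK COUNT.**  Two blocks of pieces `bU ∋ p` and `bV ∋ v`, local admissibility predicates, and a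
LINKED-CELL SET `linked P : Finset γ` reading the WHOLE placement of the `U`-block (locally in `bU`) in which the cell of
`v` must lie: the joint placements with `p` at `c` number at most `nU · (nR · nV)` — placements of the `U`-block with
`p` at `c`, times the linked cells of a given ADMISSIBLE `U`-placement, times placements of the `V`-block with `v` at a
given cell.  (`PlacementSkeleton.card_link_le` is the case `linked P = {x : R x (P u)}`; no disjointness is needed.)
[folklore] -/
theorem card_linkP_le (bU bV : Finset ε) (AdmU AdmV : (ε → γ) → Prop)
    (hlocU : ∀ P P' : ε → γ, (∀ b ∈ bU, P b = P' b) → (AdmU P ↔ AdmU P'))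
    (hlocV : ∀ P P' : ε → γ, (∀ b ∈ bV, P b = P' b) → (AdmV P ↔ AdmV P'))
    (linked : (ε → γ) → Finset γ) (hlocR : ∀ P P' : ε → γ, (∀ b ∈ bU, P b = P' b) → linked P = linked P')
    {p v : ε} (hp : p ∈ bU) (hv : v ∈ bV) (c c₀ : γ) {nU nR nV : ℕ}
    (hnU : (univ.filter fun P : ε → γ => AdmU P ∧ P p = c ∧ ∀ e, e ∉ bU → P e = c₀).card ≤ nU)
    (hnR : ∀ P : ε → γ, AdmU P → (linked P).card ≤ nR)
    (hnV : ∀ x, (univ.filter fun P : ε → γ => AdmV P ∧ P v = x ∧ ∀ e, e ∉ bV → P e = c₀).card ≤ nV) :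
    (univ.filter fun P : ε → γ => AdmU P ∧ AdmV P ∧ P v ∈ linked P ∧ P p = c ∧
        ∀ e, e ∉ bU ∪ bV → P e = c₀).card ≤ nU * (nR * nV) := by
  set A := univ.filter fun P : ε → γ => AdmU P ∧ AdmV P ∧ P v ∈ linked P ∧ P p = c ∧
    ∀ e, e ∉ bU ∪ bV → P e = c₀ with hA
  set SU := univ.filter fun P : ε → γ => AdmU P ∧ P p = c ∧ ∀ e, e ∉ bU → P e = c₀ with hSU
  let resU : (ε → γ) → (ε → γ) := fun P e => if e ∈ bU then P e else c₀
  let resV : (ε → γ) → (ε → γ) := fun P e => if e ∈ bV then P e else c₀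
  let FV : (ε → γ) → Finset (ε → γ) := fun PX =>
    univ.filter fun PY : ε → γ => AdmV PY ∧ PY v ∈ linked PX ∧ ∀ e, e ∉ bV → PY e = c₀
  -- (1) restriction to the two blocks is injective on `A` and lands in the fibred set
  have h1 : A.card ≤ (SU.biUnion fun PX => (FV PX).image (Prod.mk PX)).card := by
    refine card_le_card_of_injOn (fun P => (resU P, resV P)) (fun P hP => ?_) ?_
    · replace hP : P ∈ A := Finset.mem_coe.1 hP
      rw [hA, mem_filter] at hP
      obtain ⟨-, hU, hV, hR, hpc, hoff⟩ := hP
      have hPU : ∀ b ∈ bU, resU P b = P b := fun b hb => by simp [resU, hb]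
      have hPV : ∀ b ∈ bV, resV P b = P b := fun b hb => by simp [resV, hb]
      refine Finset.mem_coe.2 (mem_biUnion.2 ⟨resU P, ?_, mem_image.2 ⟨resV P, ?_, rfl⟩⟩)
      · rw [hSU, mem_filter]
        refine ⟨mem_univ _, (hlocU _ _ hPU).2 hU, by rw [hPU p hp, hpc], fun e he => by simp [resU, he]⟩
      · rw [mem_filter]
        refine ⟨mem_univ _, (hlocV _ _ hPV).2 hV, ?_, fun e he => by simp [resV, he]⟩
        rw [hPV v hv, hlocR _ _ hPU]
        exact hR
    · intro P hP P' hP' hEq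
      replace hP : P ∈ A := Finset.mem_coe.1 hP
      replace hP' : P' ∈ A := Finset.mem_coe.1 hP'
      rw [hA, mem_filter] at hP hP'
      obtain ⟨hEU, hEV⟩ := Prod.ext_iff.1 hEq
      funext e
      by_cases heU : e ∈ bU
      · have := congrFun hEU e; simpa [resU, heU] using this
      · by_cases heV : e ∈ bV
        · have := congrFun hEV e; simpa [resV, heV] using this
        · have hn : e ∉ bU ∪ bV := by rw [mem_union]; tauto
          rw [hP.2.2.2.2.2 e hn, hP'.2.2.2.2.2 e hn]
  -- (2) each fibre over an ADMISSIBLE `U`-placement: linked cells, then `V`-placements with `v` there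
  have h2 : ∀ PX ∈ SU, ((FV PX).image (Prod.mk PX)).card ≤ nR * nV := by
    intro PX hPX
    have hAU : AdmU PX := (mem_filter.1 hPX).2.1
    have hsub : FV PX ⊆ (linked PX).biUnion fun y =>
        univ.filter fun PY : ε → γ => AdmV PY ∧ PY v = y ∧ ∀ e, e ∉ bV → PY e = c₀ := by
      intro PY hPY
      rw [mem_filter] at hPY
      obtain ⟨-, hV, hR, hoff⟩ := hPY
      exact mem_biUnion.2 ⟨PY v, hR, mem_filter.2 ⟨mem_univ _, hV, rfl, hoff⟩⟩
    refine card_image_le.trans ((card_le_card hsub).trans (card_biUnion_le.trans ?_))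
    refine (sum_le_sum fun y _ => hnV y).trans ?_
    rw [sum_const, smul_eq_mul]
    exact Nat.mul_le_mul_right _ (hnR PX hAU)
  -- (3) assemble
  refine h1.trans (card_biUnion_le.trans ?_)
  refine (sum_le_sum h2).trans ?_
  rw [sum_const, smul_eq_mul]
  exact Nat.mul_le_mul_right _ hnU

omit [DecidableEq ε] [Fintype ε] in
/-- the cells touching SOME block of a block set number at most its cardinality times the one-block touch count
[folklore] -/
theorem card_touch_biUnion_le (touch : ε → δ → γ → ℕ → Prop) (NT : ε → ℕ → ℕ)
    (hNT : ∀ (e : ε) (a : δ) (s : ℕ), (univ.filter fun y : γ => touch e a y s).card ≤ NT e s)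
    (S : Finset δ) (e : ε) (s : ℕ) :
    (univ.filter fun y : γ => ∃ a ∈ S, touch e a y s).card ≤ S.card * NT e s := by
  have hsub : (univ.filter fun y : γ => ∃ a ∈ S, touch e a y s) ⊆
      S.biUnion fun a => univ.filter fun y : γ => touch e a y s := by
    intro y hy
    obtain ⟨a, ha, hta⟩ := (mem_filter.1 hy).2
    exact mem_biUnion.2 ⟨a, ha, mem_filter.2 ⟨mem_univ _, hta⟩⟩
  refine (card_le_card hsub).trans (card_biUnion_le.trans ?_)
  refine (sum_le_sum fun a _ => hNT e a s).trans ?_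
  rw [sum_const, smul_eq_mul]

/-- The mass-form admissible placements of `G` with piece `p` at cell `c` and the junk value `c₀` off the births.
[folklore] -/
def admMSet (zoneP : ε → Gen ε → (ε → γ) → Finset δ) (touch : ε → δ → γ → ℕ → Prop) (G : Gen ε) (p : ε)
    (c c₀ : γ) : Finset (ε → γ) :=
  univ.filter fun P => AdmM zoneP touch G P ∧ P p = c ∧ ∀ e, e ∉ births G → P e = c₀

/-- **MASS-FORM MULTIPLICITY ≤ THE MASS WEIGHT.**  For a separated genealogy rooted at its root piece placed at `c`,
the mass-form admissible placements number at most `massW zmass NT G`, given: attachable sets local in the births of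
their structure (`hloc`), the placement-free cardinality majorant on admissible placements (`hcard`), and the
one-block touch count (`hNT`). [folklore] -/
theorem card_admMSet_le (zoneP : ε → Gen ε → (ε → γ) → Finset δ)
    (hloc : ∀ (e : ε) (Z : Gen ε) (P P' : ε → γ), (∀ b ∈ births Z, P b = P' b) → zoneP e Z P = zoneP e Z P')
    (touch : ε → δ → γ → ℕ → Prop) (zmass : ε → Gen ε → ℕ) (NT : ε → ℕ → ℕ)
    (hcard : ∀ (e : ε) (Z : Gen ε) (P : ε → γ), AdmM zoneP touch Z P → (zoneP e Z P).card ≤ zmass e Z)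
    (hNT : ∀ (e : ε) (a : δ) (s : ℕ), (univ.filter fun y : γ => touch e a y s).card ≤ NT e s) :
    ∀ (G : Gen ε), Separated G → ∀ c c₀ : γ, (admMSet zoneP touch G G.root c c₀).card ≤ massW zmass NT G
  | Gen.born b j, _, c, c₀ => by
      show (admMSet zoneP touch (Gen.born b j) b c c₀).card ≤ 1
      refine Finset.card_le_one.2 fun P hP P' hP' => ?_
      simp only [admMSet, AdmM, births_born, mem_singleton, true_and, mem_filter, mem_univ] at hP hP'
      funext x
      by_cases hx : x = b
      · rw [hx, hP.1, hP'.1]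
      · rw [hP.2 x hx, hP'.2 x hx]
  | Gen.renew G e h, hS, c, c₀ => card_admMSet_le zoneP hloc touch zmass NT hcard hNT G hS c c₀
  | Gen.merge X Y e, hS, c, c₀ => by
      obtain ⟨hSX, hSY, -⟩ := hS
      have ihX := fun x => card_admMSet_le zoneP hloc touch zmass NT hcard hNT X hSX x c₀
      have ihY := fun x => card_admMSet_le zoneP hloc touch zmass NT hcard hNT Y hSY x c₀
      have hlocX := fun P P' hPP => admM_congr zoneP hloc touch X (P := P) (P' := P') hPP
      have hlocY := fun P P' hPP => admM_congr zoneP hloc touch Y (P := P) (P' := P') hPP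
      by_cases hle : X.rootStep ≤ Y.rootStep
      · -- the merger's root is `X.root`; the free root is `Y.root`; the attachable set is read off `X`
        rw [root_merge_of_le e hle, massW, if_pos hle]
        have key := card_linkP_le (births X) (births Y) (AdmM zoneP touch X) (AdmM zoneP touch Y) hlocX hlocY
          (fun Q => univ.filter fun y : γ => ∃ a ∈ zoneP e X Q, touch e a y Y.rootStep)
          (fun P P' hPP => filter_congr fun y _ => by rw [hloc e X P P' hPP])
          (root_mem_births X) (root_mem_births Y) c c₀ (ihX c)
          (fun P hP => (card_touch_biUnion_le touch NT hNT (zoneP e X P) e Y.rootStep).trans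
            (Nat.mul_le_mul_right _ (hcard e X P hP)))
          ihY
        refine le_trans (le_trans (card_le_card fun P hP => ?_) key) (le_of_eq (by ring))
        simp only [admMSet, AdmM, if_pos hle, mem_filter, mem_univ, true_and] at hP
        obtain ⟨⟨h1, h2, h3⟩, h4, h5⟩ := hP
        exact mem_filter.2 ⟨mem_univ _, h1, h2, mem_filter.2 ⟨mem_univ _, h3⟩, h4, h5⟩
      · -- the merger's root is `Y.root`; the free root is `X.root`; the attachable set is read off `Y`
        rw [root_merge_of_not_le e hle, massW, if_neg hle]
        have key := card_linkP_le (births Y) (births X) (AdmM zoneP touch Y) (AdmM zoneP touch X) hlocY hlocX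
          (fun Q => univ.filter fun y : γ => ∃ a ∈ zoneP e Y Q, touch e a y X.rootStep)
          (fun P P' hPP => filter_congr fun y _ => by rw [hloc e Y P P' hPP])
          (root_mem_births Y) (root_mem_births X) c c₀ (ihY c)
          (fun P hP => (card_touch_biUnion_le touch NT hNT (zoneP e Y P) e X.rootStep).trans
            (Nat.mul_le_mul_right _ (hcard e Y P hP)))
          ihX
        refine le_trans (le_trans (card_le_card fun P hP => ?_) key) (le_of_eq (by ring))
        simp only [admMSet, AdmM, if_neg hle, mem_filter, mem_univ, true_and] at hP
        obtain ⟨⟨h1, h2, h3⟩, h4, h5⟩ := hP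
        exact mem_filter.2 ⟨mem_univ _, h2, h1, mem_filter.2 ⟨mem_univ _, h3⟩, h4,
          fun x hx => h5 x (by rwa [births_merge, union_comm])⟩

end Count

/-! ## §3 Exponent bookkeeping: one factor per merger, at exponent ONE -/

/-- **EXPONENT ON THE NOSE.**  If the touch count carries the blocking fibre of the free root,
`NT e s ≤ ν e·Λ^{st e+1−s}` (truncated subtraction; `ν, Λ ≥ 0`), and at every WELL-FORMED merge node the cardinality
majorant of EITHER partner times `ν e` is at most a factor `f (merge X Y e) e ≥ 0`, then
`massW G ≤ Λ^{partnerAges st G}·mergeProd f G` for every well-formed `G`. [folklore] -/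
theorem massW_le (W : ε → ℕ) (zmass : ε → Gen ε → ℕ) (NT : ε → ℕ → ℕ) (st : ε → ℕ) {Λ : ℝ} (hΛ : 0 ≤ Λ)
    (ν : ε → ℝ) (hNT : ∀ e s, (NT e s : ℝ) ≤ ν e * Λ ^ (st e + 1 - s))
    (f : Gen ε → ε → ℝ) (hf : ∀ X Y e, 0 ≤ f (Gen.merge X Y e) e)
    (hzm : ∀ (X Y : Gen ε) (e : ε), (Gen.merge X Y e).WF W →
      (zmass e X : ℝ) * ν e ≤ f (Gen.merge X Y e) e ∧ (zmass e Y : ℝ) * ν e ≤ f (Gen.merge X Y e) e) :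
    ∀ {G : Gen ε}, G.WF W → (massW zmass NT G : ℝ) ≤ Λ ^ partnerAges st G * mergeProd f G
  | Gen.born _ _, _ => by simp [massW, mergeProd]
  | Gen.renew G _ _, hW => by
      simpa [massW, mergeProd] using massW_le W zmass NT st hΛ ν hNT f hf hzm (G := G) hW.1
  | Gen.merge X Y e, hW => by
      have ihX := massW_le W zmass NT st hΛ ν hNT f hf hzm (G := X) hW.1
      have ihY := massW_le W zmass NT st hΛ ν hNT f hf hzm (G := Y) hW.2.1
      have pX := mergeProd_nonneg f hf X
      have pY := mergeProd_nonneg f hf Y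
      obtain ⟨hzX, hzY⟩ := hzm X Y e hW
      -- the merger's own factor: `zmass·NT ≤ f·Λ^{st e + 1 − max rootStep}` in either orientation
      have h3 : (if X.rootStep ≤ Y.rootStep then (zmass e X : ℝ) * (NT e Y.rootStep : ℝ)
            else (zmass e Y : ℝ) * (NT e X.rootStep : ℝ)) ≤
          f (Gen.merge X Y e) e * Λ ^ (st e + 1 - max X.rootStep Y.rootStep) := by
        split_ifs with hle
        · rw [max_eq_right hle]
          calc (zmass e X : ℝ) * NT e Y.rootStep ≤ zmass e X * (ν e * Λ ^ (st e + 1 - Y.rootStep)) :=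
                mul_le_mul_of_nonneg_left (hNT e _) (Nat.cast_nonneg _)
            _ = zmass e X * ν e * Λ ^ (st e + 1 - Y.rootStep) := by ring
            _ ≤ f (Gen.merge X Y e) e * Λ ^ (st e + 1 - Y.rootStep) :=
                mul_le_mul_of_nonneg_right hzX (pow_nonneg hΛ _)
        · rw [max_eq_left (le_of_lt (not_le.1 hle))]
          calc (zmass e Y : ℝ) * NT e X.rootStep ≤ zmass e Y * (ν e * Λ ^ (st e + 1 - X.rootStep)) :=
                mul_le_mul_of_nonneg_left (hNT e _) (Nat.cast_nonneg _)
            _ = zmass e Y * ν e * Λ ^ (st e + 1 - X.rootStep) := by ring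
            _ ≤ f (Gen.merge X Y e) e * Λ ^ (st e + 1 - X.rootStep) :=
                mul_le_mul_of_nonneg_right hzY (pow_nonneg hΛ _)
      rw [massW, partnerAges_merge, mergeProd]
      push_cast
      calc (massW zmass NT X : ℝ) * (massW zmass NT Y : ℝ) *
            (if X.rootStep ≤ Y.rootStep then (zmass e X : ℝ) * (NT e Y.rootStep : ℝ)
              else (zmass e Y : ℝ) * (NT e X.rootStep : ℝ))
          ≤ (Λ ^ partnerAges st X * mergeProd f X) * (Λ ^ partnerAges st Y * mergeProd f Y) *
              (f (Gen.merge X Y e) e * Λ ^ (st e + 1 - max X.rootStep Y.rootStep)) :=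
            mul_le_mul (mul_le_mul ihX ihY (Nat.cast_nonneg _) (mul_nonneg (pow_nonneg hΛ _) pX)) h3
              (by split_ifs <;> positivity)
              (mul_nonneg (mul_nonneg (pow_nonneg hΛ _) pX) (mul_nonneg (pow_nonneg hΛ _) pY))
        _ = Λ ^ (partnerAges st X + partnerAges st Y + (st e + 1 - max X.rootStep Y.rootStep)) *
              (mergeProd f X * mergeProd f Y * f (Gen.merge X Y e) e) := by
            rw [pow_add, pow_add]; ring

section Root

variable [Fintype ε] [Fintype γ] [DecidableEq γ]

open scoped Classical

/-- **THE ASSEMBLED MASS-FORM MULTIPLICITY BOUND**: for a well-formed genealogy with its root piece at `c`, the mass-form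
admissible placements number at most `Λ^{partnerAges st G}·mergeProd f G` — ONE factor `f` per merge node, at exponent
one. [folklore] -/
theorem card_admMSet_root_le (W : ε → ℕ) (zoneP : ε → Gen ε → (ε → γ) → Finset δ)
    (hloc : ∀ (e : ε) (Z : Gen ε) (P P' : ε → γ), (∀ b ∈ births Z, P b = P' b) → zoneP e Z P = zoneP e Z P')
    (touch : ε → δ → γ → ℕ → Prop) (zmass : ε → Gen ε → ℕ) (NT : ε → ℕ → ℕ)
    (hcard : ∀ (e : ε) (Z : Gen ε) (P : ε → γ), AdmM zoneP touch Z P → (zoneP e Z P).card ≤ zmass e Z)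
    (hNT : ∀ (e : ε) (a : δ) (s : ℕ), (univ.filter fun y : γ => touch e a y s).card ≤ NT e s)
    (st : ε → ℕ) {Λ : ℝ} (hΛ : 0 ≤ Λ) (ν : ε → ℝ) (hNT' : ∀ e s, (NT e s : ℝ) ≤ ν e * Λ ^ (st e + 1 - s))
    (f : Gen ε → ε → ℝ) (hf : ∀ X Y e, 0 ≤ f (Gen.merge X Y e) e)
    (hzm : ∀ (X Y : Gen ε) (e : ε), (Gen.merge X Y e).WF W →
      (zmass e X : ℝ) * ν e ≤ f (Gen.merge X Y e) e ∧ (zmass e Y : ℝ) * ν e ≤ f (Gen.merge X Y e) e)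
    {G : Gen ε} (hW : G.WF W) (c c₀ : γ) :
    ((admMSet zoneP touch G G.root c c₀).card : ℝ) ≤ Λ ^ partnerAges st G * mergeProd f G := by
  have h1 : ((admMSet zoneP touch G G.root c c₀).card : ℝ) ≤ (massW zmass NT G : ℝ) := by
    exact_mod_cast card_admMSet_le zoneP hloc touch zmass NT hcard hNT G (separated_of_wf W hW) c c₀
  exact h1.trans (massW_le W zmass NT st hΛ ν hNT' f hf hzm hW)

/-- **THE CROWD FORM, EXPONENT ONE.**  With a constant touch shape `NT e s ≤ M₀·Λ^{st e+1−s}` and the cardinality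
majorant dominated at every well-formed merge node by the merged structure's discounted weighted activity,
`zmass e Z ≤ Cz·qZ wt σ st (merge X Y e) (st e)` (`Z` either partner; row S6g′(a)'s currency), the mass-form admissible
placements number at most `Λ^{partnerAges st G}·(M₀·Cz)^{mergeCount G}·mergeProd q_Z G` — the Z-form bound of
`ZoneDrivers.card_admZSet_root_le_crowd` with `q_Z^d` replaced by `q_Z`. [folklore] -/
theorem card_admMSet_root_le_crowd (W : ε → ℕ) (zoneP : ε → Gen ε → (ε → γ) → Finset δ)
    (hloc : ∀ (e : ε) (Z : Gen ε) (P P' : ε → γ), (∀ b ∈ births Z, P b = P' b) → zoneP e Z P = zoneP e Z P')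
    (touch : ε → δ → γ → ℕ → Prop) (zmass : ε → Gen ε → ℕ) (NT : ε → ℕ → ℕ)
    (hcard : ∀ (e : ε) (Z : Gen ε) (P : ε → γ), AdmM zoneP touch Z P → (zoneP e Z P).card ≤ zmass e Z)
    (hNT : ∀ (e : ε) (a : δ) (s : ℕ), (univ.filter fun y : γ => touch e a y s).card ≤ NT e s)
    (st : ε → ℕ) {Λ M₀ Cz σ : ℝ} (hΛ : 0 ≤ Λ) (hM₀ : 0 ≤ M₀) (hCz : 0 ≤ Cz) (hσ : 0 ≤ σ)
    (hNT' : ∀ e s, (NT e s : ℝ) ≤ M₀ * Λ ^ (st e + 1 - s)) (wt : ε → ℝ) (hwt : ∀ w, 0 ≤ wt w)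
    (hzm : ∀ (X Y : Gen ε) (e : ε), (Gen.merge X Y e).WF W →
      (zmass e X : ℝ) ≤ Cz * qZ wt σ st (Gen.merge X Y e) (st e) ∧
        (zmass e Y : ℝ) ≤ Cz * qZ wt σ st (Gen.merge X Y e) (st e))
    {G : Gen ε} (hW : G.WF W) (c c₀ : γ) :
    ((admMSet zoneP touch G G.root c c₀).card : ℝ) ≤ Λ ^ partnerAges st G *
      ((M₀ * Cz) ^ mergeCount G * mergeProd (fun Z e => qZ wt σ st Z (st e)) G) := by
  have hq0 : ∀ Z t, 0 ≤ qZ wt σ st Z t := fun Z t =>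
    sum_nonneg fun w _ => mul_nonneg (hwt w) (pow_nonneg hσ _)
  have hfac : ∀ (X Y : Gen ε) (e : ε), (Gen.merge X Y e).WF W →
      (zmass e X : ℝ) * M₀ ≤ M₀ * Cz * qZ wt σ st (Gen.merge X Y e) (st e) ∧
        (zmass e Y : ℝ) * M₀ ≤ M₀ * Cz * qZ wt σ st (Gen.merge X Y e) (st e) := by
    intro X Y e hWm
    obtain ⟨hX, hY⟩ := hzm X Y e hWm
    constructor
    · calc (zmass e X : ℝ) * M₀ ≤ Cz * qZ wt σ st (Gen.merge X Y e) (st e) * M₀ :=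
          mul_le_mul_of_nonneg_right hX hM₀
        _ = M₀ * Cz * qZ wt σ st (Gen.merge X Y e) (st e) := by ring
    · calc (zmass e Y : ℝ) * M₀ ≤ Cz * qZ wt σ st (Gen.merge X Y e) (st e) * M₀ :=
          mul_le_mul_of_nonneg_right hY hM₀
        _ = M₀ * Cz * qZ wt σ st (Gen.merge X Y e) (st e) := by ring
  have h1 := card_admMSet_root_le W zoneP hloc touch zmass NT hcard hNT st hΛ (fun _ => M₀) hNT'
    (fun Z e => M₀ * Cz * qZ wt σ st Z (st e)) (fun X Y e => mul_nonneg (mul_nonneg hM₀ hCz) (hq0 _ _)) hfac hW c c₀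
  have h2 : mergeProd (fun Z e => M₀ * Cz * qZ wt σ st Z (st e)) G =
      (M₀ * Cz) ^ mergeCount G * mergeProd (fun Z e => qZ wt σ st Z (st e)) G := by
    rw [← mergeProd_const, ← mergeProd_mul]
  rw [h2] at h1
  exact h1

end Root

/-! ## §4 Sanity -/

namespace Sanity

/-- a chain of two mergers, each attaching one bare birth of step `1` to the accumulated structure: ONE factor
`zmass·NT` per merger (the second reads the attachable set of the two-birth structure) [folklore] -/
example (zmass : ℕ → Gen ℕ → ℕ) (NT : ℕ → ℕ → ℕ) :
    massW zmass NT (Gen.merge (Gen.merge (Gen.born 0 1) (Gen.born 1 1) 10) (Gen.born 2 1) 11) =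
      zmass 10 (Gen.born 0 1) * NT 10 1 * (zmass 11 (Gen.merge (Gen.born 0 1) (Gen.born 1 1) 10) * NT 11 1) := by
  simp [massW, Gen.rootStep]

end Sanity

end

end Summit.QuantumFields.BalabanUV.T4Continuum.HistoryMassPlacement
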